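/-
Origin: expansion seat `planner-pub-hodgecm-mc-glue-1-g11-0`, handover #SG41 2026-08-20T16:55:47Z md5 581c74bec5b8 (REPLACE; pre md5 7d7ee93c9e0c → new md5 581c74bec5b8; 165 l.; (μ4) scope-guard rewrite of the RUN-55 installed file; family glue-1; compiled ok 0 proof-hole) (`HOME/mc/pub-hodgecm-mc-glue-1-g11/stage56/HodgeCM/Model/E2InstanceOGR21AEPISTRDSW.lean`, md5 581c74bec5b8, 165 lines);
landed by the second packager p2 gen 10 (p2-g10) in gate run 56 REPLACES the earlier landed copy of `HodgeCM/Model/E2InstanceOGR21AEPISTRDSW.lean` (seat copy carried the packager Origin header of an earlier run (stripped)).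
-/
/-
Origin: CONSTRUCTION seat `planner-pub-hodgecm-mc-glue-1-g10-0` (unit pub-hodgecm-mc-glue-1-g10, gen 10 of mc-glue-1, node E ASSEMBLER),
generated from glue-1's #397S `HodgeCM/Model/E2InstanceOGR21AEPISTRDS.lean` and the E-level residual family texts `jD homg homg₃₄` of glue-1's
installed #398 `HodgeCM/Model/E2InstanceOGR21AEPISCW.lean` (from binder-2 #56) by `tools/gen_ogistrdsw.py` (= `gen_ogistrdmw.py` re-based `μ♯ ↦ μ♯♯`);
KERNEL only: 1 theorem, 0 defs; intended closure {propext, Classical.choice, Quot.sound}.  The ROW-4/18/19 W PIN CHILD OF THE `μ♯♯` CHILD: `W` pinned at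
binder-2's census family at the constructed pin's character, rows 18/19 at binder-2 RUN-46 #78 `HypCensus.hyp12/34_of_census_R1At` modulo `homg homg₃₄`
ONLY (exactly as RUN-47 #398R does on #397M); a closing-chain leaf beside E — record status is the lead's ruling, not this file's claim.
-/
import Summits.HodgeConjecture.HodgeCM.Model.E2InstanceOGR21AEPISTRDS
import Summits.HodgeConjecture.HodgeCM.Model.HypCensus.KappaJoin

noncomputable section

open scoped TensorProduct InnerProductSpace Matrix

open Literature.NumberTheory.Automorphic Literature.NumberTheory.Weil1964
open Literature.NumberTheory.GelbartRogawski1991.UnitaryDualPair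
open HodgeCM.Adelic HodgeCM.PerL34
open scoped Classical
open Literature.Geometry.ComplexHyperbolic.BallModel (U21 x₀ stabilizerEquivK21)
open Literature.NumberTheory.Automorphic.U21 (K21 matA sclD)

/-!
# E2InstanceOGR21AEPISTRDSW — the row-4/18/19 W pin child of the `μ♯♯` child `perL_picardCM_r21AEOGISTRDS` at the R1 pin

`perL_picardCM_r21AEOGISTRDSW` = `perL_picardCM_r21AEOGISTRDS` (#397S: the full (R1) child at `μ♯♯ := ArchSideTerm.muSharp₂₃ μ` (theta-3 RUN-48 (K10)) with (J-μ)₁₂₃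
discharged modulo (SV), 15 groups `hA W hGR hGR₀ hGR₁ hGR₂ hGR₃ μ hSV hR hΘ gen12 real34 hyp12 hyp34`) with row 4 `W` PINNED at binder-2's census
family AT THE CONSTRUCTED PIN'S (J-η) CHARACTER — `W := HypCensus.Wcm hGR η″ hη″ hηc″`, `η″ := EtaChi.η (SInstance.χVR hGR hGR₀ hGR₁)
(SInstance.χWR hGR hGR₀ hGR₁ μ♯♯)` (`hη″ hηc″ := EtaChi.hη / EtaChi.hηc`; under the guard this IS the character of the pin `SInstance.SROGTC hGR hGR₀..₃ μ♯♯ …`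
by sinst-1's `SInstance.SROGTC_eq_archSideOfT`) — and rows 18 `hyp12` / 19 `hyp34` supplied by binder-2's RUN-46 #78 `HypCensus.hyp12_of_census_R1At` /
`HypCensus.hyp34_of_census_R1At` (`HypCensus/KappaJoin` §3) applied pointwise with the context datum INSTANTIATED `jD := fun _ _ => (0 : Fin 6)`
(binder-2-g14 DATA NOTE 2026-08-20) — byte-for-byte the construction of RUN-47 #398R `perL_picardCM_r21AEOGISTRDMW` on #397M, re-based `μ♯ ↦ μ♯♯`:
the two residual families `homg homg₃₄` are glue-1 #398's E-level family texts (installed `E2InstanceOGR21AEPISCW`, from binder-2 #56) re-pinned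
`χV ↦ SInstance.χVR hGR hGR₀ hGR₁`, `μ ↦ μ♯♯`, `jD V c ↦ fun _ _ => 0`; rows 16 `gen12` / 17 `real34` STAY (their producers of record, binder-1 #37/#42,
are typed at the ν-free pin `SROG`); their texts and `hΘ`'s are #397S's with `W ↦` the pin, byte-for-byte otherwise.
Binder groups: `hA hGR hGR₀ hGR₁ hGR₂ hGR₃ μ hSV hR hΘ gen12 real34 homg homg₃₄` (14 = 15 − 3 + 2: `W hyp12 hyp34` out, `homg homg₃₄` in).
RESIDUALS displayed AS TYPED, NOT discharged: (SV) `hSV` is the (STRIP) ∘ (VT) hypothesis of sinst-1 #1218 (period-1's lane); `homg`/`homg₃₄` are the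
(J-T12)/(J-T34) `∀ φ` junctions shared by rows 17–19, FALSE AS TYPED at any good context with a Σ₁₂ place of ε_b = −1 (binder-2 DIVERGENCE b2g11-1 +
addendum; lead RULING SUPPLEMENT 5, 2026-08-20: fix (B1) = an orientation-aware `PlaceKind` REPLACED inside E's cone at RUN 48+, these binder TEXTS
byte-identical, the junction then a theorem modulo (J-μ) `hμ`); so this leaf is a TYPED SOCKET for rows 4/18/19 and (J-μ)₂₃ at the R1 pin and claims
no discharge; conclusion `Universe.PerL` unchanged; proof = ONE application.  ADDITIVE LEAF of the closing chain beside E; no new definition, record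
or cite enters; nothing of PerL ∕ QW8 is claimed.
-/

namespace HodgeCM

namespace Model

open HodgeCM.Model.ArchSideTerm
open scoped SchwartzMap
open NumberField.mixedEmbedding (mixedSpace)
open HodgeCM.Universe (AdelicThetaCore AdelicThetaCore₀ SideData ThetaModel ModelAxiomsPerL)
open Literature.AlgebraicGeometry.HodgeTheory
open Literature.AlgebraicGeometry.ComplexMultiplication (Shimura1998_Thm3_isogenousPower Shimura1998_Thm2_Cor)
open Literature.NumberTheory.Automorphic.PicardCM
open Literature.NumberTheory.Transcendental (Arapura2012_Cor_15_4_6)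
open HodgeCM.CMTypeOps (inflate)
open HodgeCM.Model.SupplyResidual (ClassSupplyPackN)
open HodgeCM.Model.ThetaSpace

variable (hHD : exists_isReal_hodgeModel) (hI : hodgePQ_independent_of_hodgeModel)
  (h₁ : BallQuotientUniformised)  (h₃ : CMAbelianVarietyEigenbasisRealised)

/-- **ROW-4/18/19 W PIN CHILD OF THE `μ♯♯` CHILD AT THE R1 PIN** (`W := HypCensus.Wcm hGR η″ hη″ hηc″` at the constructed pin's
character; rows 18/19 at binder-2 #78 `hyp12_of_census_R1At`/`hyp34_of_census_R1At` modulo `homg homg₃₄` only, `jD := fun _ _ => 0`; 14 binder groups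
`hA hGR hGR₀ hGR₁ hGR₂ hGR₃ μ hSV hR hΘ gen12 real34 homg homg₃₄`; (SV) and the rows 18/19 junction displayed AS TYPED — the latter FALSE as typed at
ε_b = −1 Σ₁₂ places per binder-2 DIVERGENCE b2g11-1, fix (B1) ruled (lead S5)). -/
theorem perL_picardCM_r21AEOGISTRDSW (hA : Arapura2012_Cor_15_4_6)
    (hGR : ∀ {L : CMField} {ι₁ : L →+* ℂ} (V : HermSpace3 L ι₁) (c : SeesawCtx L),
      (cmSplittingDatum (L : Type) finProdFinEquiv (frameD V) (frameD_real V) (frameD_ne V) (dW c.D) (dW_real c.D)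
        (dW_ne c.D)).CompatibleSplitting)
    (hGR₀ : ∀ {L : CMField} {ι₁ : L →+* ℂ} (V : HermSpace3 L ι₁) (c : SeesawCtx L),
      (cmSplittingDatum (L : Type) (e₁) (frameD V) (frameD_real V) (frameD_ne V) (lineVec (L : Type) (dW c.D 0))
        (fun _ => dW_real c.D 0) (fun _ => dW_ne c.D 0)).CompatibleSplitting)
    (hGR₁ : ∀ {L : CMField} {ι₁ : L →+* ℂ} (V : HermSpace3 L ι₁) (c : SeesawCtx L),
      (cmSplittingDatum (L : Type) (e₁) (frameD V) (frameD_real V) (frameD_ne V) (lineVec (L : Type) (dW c.D 1))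
        (fun _ => dW_real c.D 1) (fun _ => dW_ne c.D 1)).CompatibleSplitting)
    (hGR₂ : ∀ {L : CMField} {ι₁ : L →+* ℂ} (V : HermSpace3 L ι₁) (c : SeesawCtx L),
      (cmSplittingDatum (L : Type) (e₁) (frameD V) (frameD_real V) (frameD_ne V) (lineVec (L : Type) (dW' c.D 0))
        (fun _ => dW'_real c.D 0) (fun _ => dW'_ne c.D 0)).CompatibleSplitting)
    (hGR₃ : ∀ {L : CMField} {ι₁ : L →+* ℂ} (V : HermSpace3 L ι₁) (c : SeesawCtx L),
      (cmSplittingDatum (L : Type) (e₁) (frameD V) (frameD_real V) (frameD_ne V) (lineVec (L : Type) (dW' c.D 1))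
        (fun _ => dW'_real c.D 1) (fun _ => dW'_ne c.D 1)).CompatibleSplitting)
    (μ : ∀ {L : CMField}, SeesawCtx L → Fin 4 → NumberField.InfinitePlace L → ℤ)
    (hSV : ∀ {L : CMField} {ι₁ : L →+* ℂ} (V : HermSpace3 L ι₁) (c : SeesawCtx L) (hc : SInstance.GOG V c),
      ∃ (Y : 𝓢((Fin (3 * 2) → mixedSpace (↥(NumberField.maximalRealSubfield (L : Type)))), ℂ))
        (F : FinSB (↥(NumberField.maximalRealSubfield (L : Type))) (Fin (3 * 2))) (a : ℂ),
        cmConjLineTensorFin (L : Type) finProdFinEquiv e₁ (frameD V) (frameD_real V) (frameD_ne V) (dW c.D) (dW_real c.D) (dW_ne c.D)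
            (dW' c.D) (dW'_real c.D) (dW'_ne c.D) c.D.isoGL (isoGL_hg₀ c.D)
            (SupplyInstance.testFun (↥(NumberField.maximalRealSubfield (L : Type))) (Fin 3)
              (linePhi V (dW' c.D 0) (dW'_real c.D 0) (dW'_ne c.D 0) (SInstance.hpos_GOG V c hc).2.2.1)
              (lineX₀ V (dW' c.D 0) (dW'_real c.D 0) (dW'_ne c.D 0) (SInstance.hpos_GOG V c hc).2.2.1) 1)
            (SupplyInstance.testFun (↥(NumberField.maximalRealSubfield (L : Type))) (Fin 3)
              (linePhi V (dW' c.D 1) (dW'_real c.D 1) (dW'_ne c.D 1) (SInstance.hpos_GOG V c hc).2.2.2)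
              (lineX₀ V (dW' c.D 1) (dW'_real c.D 1) (dW'_ne c.D 1) (SInstance.hpos_GOG V c hc).2.2.2) 1) =
          piSchwartzBruhatEquiv (↥(NumberField.maximalRealSubfield (L : Type))) (Fin (3 * 2)) (Y ⊗ₜ F) ∧
        Y = a • HypCensus.cmArchWeilRep (L : Type) finProdFinEquiv (frameD V) (frameD_real V) (frameD_ne V) (dW c.D) (dW_real c.D) (dW_ne c.D)
          (hGR V c) (1, conjTransportK c.D) (ctxSlotArchBox V c (SInstance.hpos_GOG V c hc).1 (SInstance.hpos_GOG V c hc).2.1))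
    (hR : DeligneMilne1982_Thm_6_20_full)
    (hΘ : ∀ {L : CMField} {ι₁ : L →+* ℂ} (V : HermSpace3 L ι₁) (c : SeesawCtx L),
      (thetaModelOf hHD hI h₁ (cmAbelianVarietyRealised_of_eigenbasis hHD hI h₃) (orientBitι L ι₁) (embOf hHD hI h₁ (cmAbelianVarietyRealised_of_eigenbasis hHD hI h₃)) (coverOf hHD hI h₁ (cmAbelianVarietyRealised_of_eigenbasis hHD hI h₃) hA) (wmOfInput (HypCensus.Wcm hGR (EtaChi.η (@SInstance.χVR @hGR @hGR₀ @hGR₁) (@SInstance.χWR @hGR @hGR₀ @hGR₁ (ArchSideTerm.muSharp₂₃ @μ))) (EtaChi.hη (@SInstance.χVR @hGR @hGR₀ @hGR₁) (@SInstance.χWR @hGR @hGR₀ @hGR₁ (ArchSideTerm.muSharp₂₃ @μ))) (EtaChi.hηc (@SInstance.χVR @hGR @hGR₀ @hGR₁) (@SInstance.χWR @hGR @hGR₀ @hGR₁ (ArchSideTerm.muSharp₂₃ @μ))))) (thetaOf _ (thetaClassInputOf _ (fun V c => thetaSpaceInputOf hHD hI h₁ (cmAbelianVarietyRealised_of_eigenbasis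 hHD hI h₃) (SInstance.SROGTC @hGR @hGR₀ @hGR₁ @hGR₂ @hGR₃ (ArchSideTerm.muSharp₂₃ @μ) (ArchSideTerm.hΔ₁_GOG_muSharp₂₃ @hGR @hGR₀ @hGR₁ @hGR₂ @hGR₃ @μ) (ArchSideTerm.hΔ₂_GOG_muSharp₂₃ @hGR @hGR₀ @hGR₁ @hGR₂ @hGR₃ @μ hSV) (ArchSideTerm.hΔ₃_GOG_muSharp₂₃ @hGR @hGR₀ @hGR₁ @hGR₂ @hGR₃ @μ hSV)) V c))) (d12Of (ArchSideTerm.muSharp₂₃ @μ)) (d34Of (ArchSideTerm.muSharp₂₃ @μ))).GoodCtx ι₁ c → Module.finrank ℚ c.K = 6 ∧ IsNormalClosure ℚ c.K L ∧ (Module.finrank ℚ L = 24 ∨ Module.finrank ℚ L = 48) →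
      (NumberField.InfinitePlace.mk ι₁).embedding = ι₁ →
      ∀ i : Fin 4, ∃ Γ₀ : Level V, ∀ Γ ≤ Γ₀,
        ∃ D : CommonReflexInput c.K (c.Ψ i) c.σ,
          (thetaModelOf hHD hI h₁ (cmAbelianVarietyRealised_of_eigenbasis hHD hI h₃) (orientBitι L ι₁) (embOf hHD hI h₁ (cmAbelianVarietyRealised_of_eigenbasis hHD hI h₃)) (coverOf hHD hI h₁ (cmAbelianVarietyRealised_of_eigenbasis hHD hI h₃) hA) (wmOfInput (HypCensus.Wcm hGR (EtaChi.η (@SInstance.χVR @hGR @hGR₀ @hGR₁) (@SInstance.χWR @hGR @hGR₀ @hGR₁ (ArchSideTerm.muSharp₂₃ @μ))) (EtaChi.hη (@SInstance.χVR @hGR @hGR₀ @hGR₁) (@SInstance.χWR @hGR @hGR₀ @hGR₁ (ArchSideTerm.muSharp₂₃ @μ))) (EtaChi.hηc (@SInstance.χVR @hGR @hGR₀ @hGR₁) (@SInstance.χWR @hGR @hGR₀ @hGR₁ (ArchSideTerm.muSharp₂₃ @μ))))) (thetaOf _ (thetaClassInputOf _ (fun V c => thetaSpaceInputOf hHD hI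 h₁ (cmAbelianVarietyRealised_of_eigenbasis hHD hI h₃) (SInstance.SROGTC @hGR @hGR₀ @hGR₁ @hGR₂ @hGR₃ (ArchSideTerm.muSharp₂₃ @μ) (ArchSideTerm.hΔ₁_GOG_muSharp₂₃ @hGR @hGR₀ @hGR₁ @hGR₂ @hGR₃ @μ) (ArchSideTerm.hΔ₂_GOG_muSharp₂₃ @hGR @hGR₀ @hGR₁ @hGR₂ @hGR₃ @μ hSV) (ArchSideTerm.hΔ₃_GOG_muSharp₂₃ @hGR @hGR₀ @hGR₁ @hGR₂ @hGR₃ @μ hSV)) V c))) (d12Of (ArchSideTerm.muSharp₂₃ @μ)) (d34Of (ArchSideTerm.muSharp₂₃ @μ))).Theta V c i Γ ⊆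
            Submodule.span ℂ (D.surfaceClasses hHD hI h₁ (cmAbelianVarietyRealised_of_eigenbasis hHD hI h₃) V Γ))
    (gen12 : ∀ {L : CMField} {ι₁ : L →+* ℂ} (V : HermSpace3 L ι₁) (c : SeesawCtx L),
      (thetaModelOf hHD hI h₁ (cmAbelianVarietyRealised_of_eigenbasis hHD hI h₃) (orientBitι L ι₁) (embOf hHD hI h₁ (cmAbelianVarietyRealised_of_eigenbasis hHD hI h₃)) (coverOf hHD hI h₁ (cmAbelianVarietyRealised_of_eigenbasis hHD hI h₃) hA) (wmOfInput (HypCensus.Wcm hGR (EtaChi.η (@SInstance.χVR @hGR @hGR₀ @hGR₁) (@SInstance.χWR @hGR @hGR₀ @hGR₁ (ArchSideTerm.muSharp₂₃ @μ))) (EtaChi.hη (@SInstance.χVR @hGR @hGR₀ @hGR₁) (@SInstance.χWR @hGR @hGR₀ @hGR₁ (ArchSideTerm.muSharp₂₃ @μ))) (EtaChi.hηc (@SInstance.χVR @hGR @hGR₀ @hGR₁) (@SInstance.χWR @hGR @hGR₀ @hGR₁ (ArchSideTerm.muSharp₂₃ @μ))))) (thetaOf _ (thetaClassInputOf _ (fun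 V c => thetaSpaceInputOf hHD hI h₁ (cmAbelianVarietyRealised_of_eigenbasis hHD hI h₃) (SInstance.SROGTC @hGR @hGR₀ @hGR₁ @hGR₂ @hGR₃ (ArchSideTerm.muSharp₂₃ @μ) (ArchSideTerm.hΔ₁_GOG_muSharp₂₃ @hGR @hGR₀ @hGR₁ @hGR₂ @hGR₃ @μ) (ArchSideTerm.hΔ₂_GOG_muSharp₂₃ @hGR @hGR₀ @hGR₁ @hGR₂ @hGR₃ @μ hSV) (ArchSideTerm.hΔ₃_GOG_muSharp₂₃ @hGR @hGR₀ @hGR₁ @hGR₂ @hGR₃ @μ hSV)) V c))) (d12Of (ArchSideTerm.muSharp₂₃ @μ)) (d34Of (ArchSideTerm.muSharp₂₃ @μ))).GoodCtx ι₁ c → Module.finrank ℚ c.K = 6 ∧ IsNormalClosure ℚ c.K L ∧ (Module.finrank ℚ L = 24 ∨ Module.finrank ℚ L = 48) →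
      (NumberField.InfinitePlace.mk ι₁).embedding = ι₁ →
      Nonempty ((thetaModelOf hHD hI h₁ (cmAbelianVarietyRealised_of_eigenbasis hHD hI h₃) (orientBitι L ι₁) (embOf hHD hI h₁ (cmAbelianVarietyRealised_of_eigenbasis hHD hI h₃)) (coverOf hHD hI h₁ (cmAbelianVarietyRealised_of_eigenbasis hHD hI h₃) hA) (wmOfInput (HypCensus.Wcm hGR (EtaChi.η (@SInstance.χVR @hGR @hGR₀ @hGR₁) (@SInstance.χWR @hGR @hGR₀ @hGR₁ (ArchSideTerm.muSharp₂₃ @μ))) (EtaChi.hη (@SInstance.χVR @hGR @hGR₀ @hGR₁) (@SInstance.χWR @hGR @hGR₀ @hGR₁ (ArchSideTerm.muSharp₂₃ @μ))) (EtaChi.hηc (@SInstance.χVR @hGR @hGR₀ @hGR₁) (@SInstance.χWR @hGR @hGR₀ @hGR₁ (ArchSideTerm.muSharp₂₃ @μ))))) (thetaOf _ (thetaClassInputOf _ (fun V c => thetaSpaceInputOf hHD hI h₁ (cmAbelianVarietyRealised_of_eigenbasis hHD hI h₃) (SInstance.SROGTC @hGR @hGR₀ @hGR₁ @hGR₂ @hGR₃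 (ArchSideTerm.muSharp₂₃ @μ) (ArchSideTerm.hΔ₁_GOG_muSharp₂₃ @hGR @hGR₀ @hGR₁ @hGR₂ @hGR₃ @μ) (ArchSideTerm.hΔ₂_GOG_muSharp₂₃ @hGR @hGR₀ @hGR₁ @hGR₂ @hGR₃ @μ hSV) (ArchSideTerm.hΔ₃_GOG_muSharp₂₃ @hGR @hGR₀ @hGR₁ @hGR₂ @hGR₃ @μ hSV)) V c))) (d12Of (ArchSideTerm.muSharp₂₃ @μ)) (d34Of (ArchSideTerm.muSharp₂₃ @μ))).Gen12FunBridge V c))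
    (real34 : ∀ {L : CMField} {ι₁ : L →+* ℂ} (V : HermSpace3 L ι₁) (c : SeesawCtx L),
      (thetaModelOf hHD hI h₁ (cmAbelianVarietyRealised_of_eigenbasis hHD hI h₃) (orientBitι L ι₁) (embOf hHD hI h₁ (cmAbelianVarietyRealised_of_eigenbasis hHD hI h₃)) (coverOf hHD hI h₁ (cmAbelianVarietyRealised_of_eigenbasis hHD hI h₃) hA) (wmOfInput (HypCensus.Wcm hGR (EtaChi.η (@SInstance.χVR @hGR @hGR₀ @hGR₁) (@SInstance.χWR @hGR @hGR₀ @hGR₁ (ArchSideTerm.muSharp₂₃ @μ))) (EtaChi.hη (@SInstance.χVR @hGR @hGR₀ @hGR₁) (@SInstance.χWR @hGR @hGR₀ @hGR₁ (ArchSideTerm.muSharp₂₃ @μ))) (EtaChi.hηc (@SInstance.χVR @hGR @hGR₀ @hGR₁) (@SInstance.χWR @hGR @hGR₀ @hGR₁ (ArchSideTerm.muSharp₂₃ @μ))))) (thetaOf _ (thetaClassInputOf _ (fun V c => thetaSpaceInputOf hHD hI h₁ (cmAbelianVarietyRealised_of_eigenbasis hHD hI h₃) (SInstance.SROGTC @hGR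 @hGR₀ @hGR₁ @hGR₂ @hGR₃ (ArchSideTerm.muSharp₂₃ @μ) (ArchSideTerm.hΔ₁_GOG_muSharp₂₃ @hGR @hGR₀ @hGR₁ @hGR₂ @hGR₃ @μ) (ArchSideTerm.hΔ₂_GOG_muSharp₂₃ @hGR @hGR₀ @hGR₁ @hGR₂ @hGR₃ @μ hSV) (ArchSideTerm.hΔ₃_GOG_muSharp₂₃ @hGR @hGR₀ @hGR₁ @hGR₂ @hGR₃ @μ hSV)) V c))) (d12Of (ArchSideTerm.muSharp₂₃ @μ)) (d34Of (ArchSideTerm.muSharp₂₃ @μ))).GoodCtx ι₁ c → Module.finrank ℚ c.K = 6 ∧ IsNormalClosure ℚ c.K L ∧ (Module.finrank ℚ L = 24 ∨ Module.finrank ℚ L = 48) →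
      (NumberField.InfinitePlace.mk ι₁).embedding = ι₁ →
      Nonempty ((thetaModelOf hHD hI h₁ (cmAbelianVarietyRealised_of_eigenbasis hHD hI h₃) (orientBitι L ι₁) (embOf hHD hI h₁ (cmAbelianVarietyRealised_of_eigenbasis hHD hI h₃)) (coverOf hHD hI h₁ (cmAbelianVarietyRealised_of_eigenbasis hHD hI h₃) hA) (wmOfInput (HypCensus.Wcm hGR (EtaChi.η (@SInstance.χVR @hGR @hGR₀ @hGR₁) (@SInstance.χWR @hGR @hGR₀ @hGR₁ (ArchSideTerm.muSharp₂₃ @μ))) (EtaChi.hη (@SInstance.χVR @hGR @hGR₀ @hGR₁) (@SInstance.χWR @hGR @hGR₀ @hGR₁ (ArchSideTerm.muSharp₂₃ @μ))) (EtaChi.hηc (@SInstance.χVR @hGR @hGR₀ @hGR₁) (@SInstance.χWR @hGR @hGR₀ @hGR₁ (ArchSideTerm.muSharp₂₃ @μ))))) (thetaOf _ (thetaClassInputOf _ (fun V c => thetaSpaceInputOf hHD hI h₁ (cmAbelianVarietyRealised_of_eigenbasis hHD hI h₃) (SInstance.SROGTC @hGR @hGR₀ @hGR₁ @hGR₂ @hGR₃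 (ArchSideTerm.muSharp₂₃ @μ) (ArchSideTerm.hΔ₁_GOG_muSharp₂₃ @hGR @hGR₀ @hGR₁ @hGR₂ @hGR₃ @μ) (ArchSideTerm.hΔ₂_GOG_muSharp₂₃ @hGR @hGR₀ @hGR₁ @hGR₂ @hGR₃ @μ hSV) (ArchSideTerm.hΔ₃_GOG_muSharp₂₃ @hGR @hGR₀ @hGR₁ @hGR₂ @hGR₃ @μ hSV)) V c))) (d12Of (ArchSideTerm.muSharp₂₃ @μ)) (d34Of (ArchSideTerm.muSharp₂₃ @μ))).Real34FunBridge V c))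
    (homg : ∀ {L : CMField} {ι₁ : L →+* ℂ} (V : HermSpace3 L ι₁) (c : SeesawCtx L)
      (hW : (∀ j, 0 < (ι₁ ((dW c.D) j)).re) ∨ ∀ j, (ι₁ ((dW c.D) j)).re < 0) (f : FinSB ↥(NumberField.maximalRealSubfield L) (Fin 6))
      (t : (HypCensus.printedAt V c.D hW (fun _ _ => (0 : Fin 6)) (fun w => -(ArchSideTerm.muSharp₂₃ @μ) c 0 w) (fun w => -(ArchSideTerm.muSharp₂₃ @μ) c 1 w)).Tg)
      (φ : (HypCensus.printedAt V c.D hW (fun _ _ => (0 : Fin 6)) (fun w => -(ArchSideTerm.muSharp₂₃ @μ) c 0 w) (fun w => -(ArchSideTerm.muSharp₂₃ @μ) c 1 w)).F),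
      HypCensus.omgW (HypCensus.Wcm hGR (EtaChi.η (@SInstance.χVR @hGR @hGR₀ @hGR₁) (@SInstance.χWR @hGR @hGR₀ @hGR₁ (ArchSideTerm.muSharp₂₃ @μ))) (EtaChi.hη (@SInstance.χVR @hGR @hGR₀ @hGR₁) (@SInstance.χWR @hGR @hGR₀ @hGR₁ (ArchSideTerm.muSharp₂₃ @μ))) (EtaChi.hηc (@SInstance.χVR @hGR @hGR₀ @hGR₁) (@SInstance.χWR @hGR @hGR₀ @hGR₁ (ArchSideTerm.muSharp₂₃ @μ))) V c)
          (_root_.NumberField.SeesawArchTorus.printedTorusHom (HypCensus.kindOf (L : Type) (frameD V) (frameD_real V) (dW c.D) (dW_real c.D) ι₁ (HypCensus.datumAt V c.D (fun _ _ => (0 : Fin 6)) (HypCensus.jIOf V c.D hW)))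
            (HypCensus.lamOf (L : Type) (frameD V) (frameD_real V) (dW c.D) (dW_real c.D) ι₁ (HypCensus.datumAt V c.D (fun _ _ => (0 : Fin 6)) (HypCensus.jIOf V c.D hW)))
            (HypCensus.lamOf_ne_zero (L : Type) (frameD V) (frameD_real V) (dW c.D) (dW_real c.D) ι₁ (HypCensus.datumAt V c.D (fun _ _ => (0 : Fin 6)) (HypCensus.jIOf V c.D hW)))
            (c.D.jT₁₂.toMonoidHom.comp (_root_.NumberField.SeesawArchTorus.toAdeles (L : Type)))
            (Fock.PrintDict.pinnedVacs (HypCensus.kindOf (L : Type) (frameD V) (frameD_real V) (dW c.D) (dW_real c.D) ι₁ (HypCensus.datumAt V c.D (fun _ _ => (0 : Fin 6)) (HypCensus.jIOf V c.D hW)))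
              (fun w => -(ArchSideTerm.muSharp₂₃ @μ) c 0 w) (fun w => -(ArchSideTerm.muSharp₂₃ @μ) c 1 w)) t)
          (HypCensus.ins (L : Type) (frameD V) (frameD_real V) (frameD_ne V) (dW c.D) (dW_real c.D) (dW_ne c.D) ι₁ (HypCensus.datumAt V c.D (fun _ _ => (0 : Fin 6)) (HypCensus.jIOf V c.D hW))
            (fun w => -(ArchSideTerm.muSharp₂₃ @μ) c 0 w) (fun w => -(ArchSideTerm.muSharp₂₃ @μ) c 1 w) f φ) =
        HypCensus.ins (L : Type) (frameD V) (frameD_real V) (frameD_ne V) (dW c.D) (dW_real c.D) (dW_ne c.D) ι₁ (HypCensus.datumAt V c.D (fun _ _ => (0 : Fin 6)) (HypCensus.jIOf V c.D hW))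
          (fun w => -(ArchSideTerm.muSharp₂₃ @μ) c 0 w) (fun w => -(ArchSideTerm.muSharp₂₃ @μ) c 1 w) f ((HypCensus.printedAt V c.D hW (fun _ _ => (0 : Fin 6)) (fun w => -(ArchSideTerm.muSharp₂₃ @μ) c 0 w) (fun w => -(ArchSideTerm.muSharp₂₃ @μ) c 1 w)).ωT t φ))
    (homg₃₄ : ∀ {L : CMField} {ι₁ : L →+* ℂ} (V : HermSpace3 L ι₁) (c : SeesawCtx L)
      (hW : (∀ j, 0 < (ι₁ ((dW c.D) j)).re) ∨ ∀ j, (ι₁ ((dW c.D) j)).re < 0) (f : FinSB ↥(NumberField.maximalRealSubfield L) (Fin 6))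
      (t : (HypCensus.printedAt V c.D hW (fun _ _ => (0 : Fin 6)) (fun w => -(ArchSideTerm.muSharp₂₃ @μ) c 2 w) (fun w => -(ArchSideTerm.muSharp₂₃ @μ) c 3 w)).Tg)
      (φ : (HypCensus.printedAt V c.D hW (fun _ _ => (0 : Fin 6)) (fun w => -(ArchSideTerm.muSharp₂₃ @μ) c 2 w) (fun w => -(ArchSideTerm.muSharp₂₃ @μ) c 3 w)).F),
      HypCensus.omgW (HypCensus.Wcm hGR (EtaChi.η (@SInstance.χVR @hGR @hGR₀ @hGR₁) (@SInstance.χWR @hGR @hGR₀ @hGR₁ (ArchSideTerm.muSharp₂₃ @μ))) (EtaChi.hη (@SInstance.χVR @hGR @hGR₀ @hGR₁) (@SInstance.χWR @hGR @hGR₀ @hGR₁ (ArchSideTerm.muSharp₂₃ @μ))) (EtaChi.hηc (@SInstance.χVR @hGR @hGR₀ @hGR₁) (@SInstance.χWR @hGR @hGR₀ @hGR₁ (ArchSideTerm.muSharp₂₃ @μ))) V c)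
          (_root_.NumberField.SeesawArchTorus.printedTorusHom (HypCensus.kindOf (L : Type) (frameD V) (frameD_real V) (dW c.D) (dW_real c.D) ι₁ (HypCensus.datumAt V c.D (fun _ _ => (0 : Fin 6)) (HypCensus.jIOf V c.D hW)))
            (HypCensus.lamOf (L : Type) (frameD V) (frameD_real V) (dW c.D) (dW_real c.D) ι₁ (HypCensus.datumAt V c.D (fun _ _ => (0 : Fin 6)) (HypCensus.jIOf V c.D hW)))
            (HypCensus.lamOf_ne_zero (L : Type) (frameD V) (frameD_real V) (dW c.D) (dW_real c.D) ι₁ (HypCensus.datumAt V c.D (fun _ _ => (0 : Fin 6)) (HypCensus.jIOf V c.D hW)))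
            (c.D.jT₃₄.toMonoidHom.comp (_root_.NumberField.SeesawArchTorus.toAdeles (L : Type)))
            (Fock.PrintDict.pinnedVacs (HypCensus.kindOf (L : Type) (frameD V) (frameD_real V) (dW c.D) (dW_real c.D) ι₁ (HypCensus.datumAt V c.D (fun _ _ => (0 : Fin 6)) (HypCensus.jIOf V c.D hW)))
              (fun w => -(ArchSideTerm.muSharp₂₃ @μ) c 2 w) (fun w => -(ArchSideTerm.muSharp₂₃ @μ) c 3 w)) t)
          (HypCensus.ins₃₄ V c.D (hGR V c) ((EtaChi.η (@SInstance.χVR @hGR @hGR₀ @hGR₁) (@SInstance.χWR @hGR @hGR₀ @hGR₁ (ArchSideTerm.muSharp₂₃ @μ))) V c) (HypCensus.datumAt V c.D (fun _ _ => (0 : Fin 6)) (HypCensus.jIOf V c.D hW)) (fun w => -(ArchSideTerm.muSharp₂₃ @μ) c 2 w) (fun w => -(ArchSideTerm.muSharp₂₃ @μ) c 3 w) f φ) =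
        HypCensus.ins₃₄ V c.D (hGR V c) ((EtaChi.η (@SInstance.χVR @hGR @hGR₀ @hGR₁) (@SInstance.χWR @hGR @hGR₀ @hGR₁ (ArchSideTerm.muSharp₂₃ @μ))) V c) (HypCensus.datumAt V c.D (fun _ _ => (0 : Fin 6)) (HypCensus.jIOf V c.D hW)) (fun w => -(ArchSideTerm.muSharp₂₃ @μ) c 2 w) (fun w => -(ArchSideTerm.muSharp₂₃ @μ) c 3 w) f
          ((HypCensus.printedAt V c.D hW (fun _ _ => (0 : Fin 6)) (fun w => -(ArchSideTerm.muSharp₂₃ @μ) c 2 w) (fun w => -(ArchSideTerm.muSharp₂₃ @μ) c 3 w)).ωT t φ)) :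
     (picardCMUniverse hHD hI h₁ (cmAbelianVarietyRealised_of_eigenbasis hHD hI h₃)).PerL :=
  perL_picardCM_r21AEOGISTRDS hHD hI h₁ h₃ hA
    (HypCensus.Wcm hGR (EtaChi.η (@SInstance.χVR @hGR @hGR₀ @hGR₁) (@SInstance.χWR @hGR @hGR₀ @hGR₁ (ArchSideTerm.muSharp₂₃ @μ))) (EtaChi.hη (@SInstance.χVR @hGR @hGR₀ @hGR₁) (@SInstance.χWR @hGR @hGR₀ @hGR₁ (ArchSideTerm.muSharp₂₃ @μ))) (EtaChi.hηc (@SInstance.χVR @hGR @hGR₀ @hGR₁) (@SInstance.χWR @hGR @hGR₀ @hGR₁ (ArchSideTerm.muSharp₂₃ @μ))))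
    hGR hGR₀ hGR₁ hGR₂ hGR₃ μ hSV hR hΘ gen12 real34
    (fun V c hc h6 hcan => HypCensus.hyp12_of_census_R1At hHD hI h₁ (cmAbelianVarietyRealised_of_eigenbasis hHD hI h₃) hA hGR hGR₀ hGR₁
      (@SInstance.χWR @hGR @hGR₀ @hGR₁ (ArchSideTerm.muSharp₂₃ @μ))
      (SInstance.SROGTC @hGR @hGR₀ @hGR₁ @hGR₂ @hGR₃ (ArchSideTerm.muSharp₂₃ @μ) (ArchSideTerm.hΔ₁_GOG_muSharp₂₃ @hGR @hGR₀ @hGR₁ @hGR₂ @hGR₃ @μ) (ArchSideTerm.hΔ₂_GOG_muSharp₂₃ @hGR @hGR₀ @hGR₁ @hGR₂ @hGR₃ @μ hSV) (ArchSideTerm.hΔ₃_GOG_muSharp₂₃ @hGR @hGR₀ @hGR₁ @hGR₂ @hGR₃ @μ hSV))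
      (ArchSideTerm.muSharp₂₃ @μ) V c hc h6.1 hcan
      (fun _ _ => (0 : Fin 6)) (homg V c))
    (fun V c hc h6 hcan => HypCensus.hyp34_of_census_R1At hHD hI h₁ (cmAbelianVarietyRealised_of_eigenbasis hHD hI h₃) hA hGR hGR₀ hGR₁
      (@SInstance.χWR @hGR @hGR₀ @hGR₁ (ArchSideTerm.muSharp₂₃ @μ))
      (SInstance.SROGTC @hGR @hGR₀ @hGR₁ @hGR₂ @hGR₃ (ArchSideTerm.muSharp₂₃ @μ) (ArchSideTerm.hΔ₁_GOG_muSharp₂₃ @hGR @hGR₀ @hGR₁ @hGR₂ @hGR₃ @μ) (ArchSideTerm.hΔ₂_GOG_muSharp₂₃ @hGR @hGR₀ @hGR₁ @hGR₂ @hGR₃ @μ hSV) (ArchSideTerm.hΔ₃_GOG_muSharp₂₃ @hGR @hGR₀ @hGR₁ @hGR₂ @hGR₃ @μ hSV))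
      (ArchSideTerm.muSharp₂₃ @μ) V c hc h6.1 hcan
      (fun _ _ => (0 : Fin 6)) (homg₃₄ V c))

end Model

end HodgeCM
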